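import Mathlib
import Summits.NavierStokesRegularity.Statement
import Literature.Analysis.FluidPDE.ClassicalSolution
import Literature.Analysis.FluidPDE.LerayHopf
import Literature.Analysis.FluidPDE.NSWave0
import Literature.Analysis.FluidPDE.NSLerayHopf
import Literature.Analysis.FluidPDE.NSVorticity

/-!
# NavierStokesRegularity — routes `Blowup` / `VorticityGeometry`: bookkeeping glue

Three formal-glue statement items, no analysis beyond the Leray–Hopf energy inequality:

* `blowup_X5a_iff_not_noBlowup` (stmt-0730): `X5a` (stmt-0152) `↔ ¬ NoBlowup` (stmt-0054),
  by unfolding `Literature.Analysis.FluidPDE.IsMaximalSmoothSolution`.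
* `blowup_b2_of_tao_sobolev_bounds` (stmt-0731) and
  `vorticityGeometry_persistence_of_tao_sobolev_bounds` (stmt-0732): the closed-slab Sobolev/`L∞`
  bound for smooth finite-energy solutions with rapidly decaying datum (taken as HYPOTHESIS, in the
  tested shape of cite item wi-04767, Tao 2011) implies `u ∈ L∞ₜL∞ₓ(0,T')` for `T' < T`
  (= stmt-0723) resp. BKM-class persistence `∀ T'' < T` (= stmt-0094) for classical Leray–Hopf
  solutions on `[0, T)`: restrict `Ico 0 T → Icc 0 T₁` (`IsClassicalNSSolutionOn.mono`,
  `uniqueDiffOn_Icc`) and feed the uniform `L²` bound `lerayHopf_lintegral_sq_le` from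
  `IsLerayHopfOn.energy_ineq_zero` + `IsLerayHopfOn.eEnergy_eq` (force `f = 0`).
-/

open Set MeasureTheory
open scoped ENNReal

namespace Literature.NS

/-- Settles stmt-NavierStokesRegularity-0730: `X5a ↔ ¬ NoBlowup` — finite-time blow-up of a
maximal smooth Leray–Hopf solution from a rapidly decaying datum (stmt-0152) is literally the
negation of the no-blow-up statement (stmt-0054), by unfolding
`Literature.Analysis.FluidPDE.IsMaximalSmoothSolution`. Pure logic. [folklore] -/
theorem blowup_X5a_iff_not_noBlowup :
    (∃ ν : ℝ, 0 < ν ∧ ∃ T : ℝ, 0 < T ∧ ∃ (u : ℝ → EuclideanSpace ℝ (Fin 3) → EuclideanSpace ℝ (Fin 3)) (p : ℝ → EuclideanSpace ℝ (Fin 3) → ℝ), Literature.Analysis.FluidPDE.IsMaximalSmoothSolution ν 0 u p T ∧ Literature.Analysis.FluidPDE.IsLerayHopfOn T ν 0 (u 0) u ∧ Literature.Analysis.FluidPDE.HasRapidSpatialDecay (u 0)) ↔ ¬ (∀ (ν T : ℝ), 0 < ν → 0 < T → ∀ (u : ℝ → EuclideanSpace ℝ (Fin 3) → EuclideanSpace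 ℝ (Fin 3)) (p : ℝ → EuclideanSpace ℝ (Fin 3) → ℝ), Literature.Analysis.FluidPDE.IsClassicalNSSolutionOn (Set.Ico 0 T) ν 0 u p → Literature.Analysis.FluidPDE.IsLerayHopfOn T ν 0 (u 0) u → Literature.Analysis.FluidPDE.HasRapidSpatialDecay (u 0) → Literature.Analysis.FluidPDE.HasSmoothExtensionPast ν 0 u T) := by
  constructor
  · rintro ⟨ν, hν, T, hT, u, p, ⟨hcl, hmax⟩, hLH, hdec⟩ h
    exact hmax (h ν T hν hT u p hcl hLH hdec)
  · intro h
    by_contra hne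
    apply h
    intro ν T hν hT u p hcl hLH hdec
    by_contra hext
    exact hne ⟨ν, hν, T, hT, u, p, ⟨hcl, hext⟩, hLH, hdec⟩

/-- Uniform `L²` bound on `[0, T]` for a Leray–Hopf solution with zero force: from the energy
inequality, `∫ ‖u t‖² ≤ 2·KE(u₀)`. [folklore] -/
theorem lerayHopf_lintegral_sq_le {ν T : ℝ} (hν : 0 ≤ ν) {u₀ : EuclideanSpace ℝ (Fin 3) → EuclideanSpace ℝ (Fin 3)}
    {u : ℝ → EuclideanSpace ℝ (Fin 3) → EuclideanSpace ℝ (Fin 3)}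
    (h : Literature.Analysis.FluidPDE.IsLerayHopfOn T ν 0 u₀ u) :
    ∃ C : ENNReal, C < ⊤ ∧ ∀ t ∈ Icc 0 T, ∫⁻ x, ‖u t x‖ₑ ^ 2 ≤ C := by
  obtain ⟨G, -, hE⟩ := h.energy_ineq_zero
  refine ⟨ENNReal.ofReal (2 * Literature.Analysis.FluidPDE.VectorCalculus.kineticEnergy u₀), ENNReal.ofReal_lt_top, fun t ht => ?_⟩
  have h1 := hE t ht
  have h2 : (0:ℝ) ≤ ν * (∫⁻ τ in Ioo 0 t, ∫⁻ x, ENNReal.ofReal (Literature.Analysis.FluidPDE.frobeniusNormSq (G τ x))).toReal :=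
    mul_nonneg hν ENNReal.toReal_nonneg
  have h3 : Literature.Analysis.FluidPDE.VectorCalculus.kineticEnergy (u t) ≤ Literature.Analysis.FluidPDE.VectorCalculus.kineticEnergy u₀ := by
    simp only [Pi.zero_apply, inner_zero_left, integral_zero, intervalIntegral.integral_zero,
      add_zero] at h1
    linarith
  have h4 := h.eEnergy_eq ht
  simp only [Literature.Analysis.FluidPDE.eEnergy] at h4
  rw [h4]
  exact ENNReal.ofReal_le_ofReal (by linarith)

/-- Settles stmt-NavierStokesRegularity-0731 (route Blowup, b2 glue): the closed-slab
Sobolev/`L∞` bound for smooth finite-energy solutions with rapidly decaying datum (hypothesis,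
the tested shape of Tao 2011 Cor 11.1 + Cor 4.3 + Thm 5.4) gives `u ∈ L∞ₜL∞ₓ` on every
`(0, T')`, `T' < T`, for a classical Leray–Hopf solution on `[0, T)`. [folklore] -/
theorem blowup_b2_of_tao_sobolev_bounds : (∀ (ν T : ℝ), 0 < ν → 0 < T → ∀ (u : ℝ → EuclideanSpace ℝ (Fin 3) → EuclideanSpace ℝ (Fin 3)) (p : ℝ → EuclideanSpace ℝ (Fin 3) → ℝ), Literature.Analysis.FluidPDE.IsClassicalNSSolutionOn (Set.Icc 0 T) ν 0 u p → (∃ C : ENNReal, C < ⊤ ∧ ∀ t ∈ Set.Icc 0 T, ∫⁻ x, ‖u t x‖ₑ ^ 2 ≤ C) → Literature.Analysis.FluidPDE.HasRapidSpatialDecay (u 0) → Literature.Analysis.FluidPDE.HasBoundedSobolevNormsOn (Set.Icc 0 T) u ∧ Literature.Analysis.FluidPDE.MemLqLp ⊤ ⊤ u (Set.Ioo 0 T)) → (∀ (ν T : ℝ), 0 < ν → 0 < T → ∀ (u : ℝ → EuclideanSpace ℝ (Fin 3) → EuclideanSpace ℝ (Fin 3)) (p : ℝ → EuclideanSpace ℝ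 (Fin 3) → ℝ), Literature.Analysis.FluidPDE.IsClassicalNSSolutionOn (Set.Ico 0 T) ν 0 u p → Literature.Analysis.FluidPDE.IsLerayHopfOn T ν 0 (u 0) u → Literature.Analysis.FluidPDE.HasRapidSpatialDecay (u 0) → ∀ T' ∈ Set.Ioo 0 T, Literature.Analysis.FluidPDE.MemLqLp ⊤ ⊤ u (Set.Ioo 0 T')) := by
  intro hslab ν T hν hT u p hsol hLH hdec T' hT'
  have hsol' : Literature.Analysis.FluidPDE.IsClassicalNSSolutionOn (Icc 0 T') ν 0 u p :=
    hsol.mono (Icc_subset_Ico_right hT'.2) (uniqueDiffOn_Icc hT'.1)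
  obtain ⟨C, hC, hCb⟩ := lerayHopf_lintegral_sq_le hν.le hLH
  exact (hslab ν T' hν hT'.1 u p hsol' ⟨C, hC, fun t ht => hCb t ⟨ht.1, ht.2.trans hT'.2.le⟩⟩ hdec).2

/-- Settles stmt-NavierStokesRegularity-0732 (route VorticityGeometry, crux #4 glue): the same
closed-slab hypothesis gives BKM-class persistence `∀ T'' < T, HasBoundedSobolevNormsOn [0,T''] u`
for a classical Leray–Hopf solution on `[0, T)` (restrict to `[0, max T'' (T/2)]`). [folklore] -/
theorem vorticityGeometry_persistence_of_tao_sobolev_bounds : (∀ (ν T : ℝ), 0 < ν → 0 < T → ∀ (u : ℝ → EuclideanSpace ℝ (Fin 3) → EuclideanSpace ℝ (Fin 3)) (p : ℝ → EuclideanSpace ℝ (Fin 3) → ℝ), Literature.Analysis.FluidPDE.IsClassicalNSSolutionOn (Set.Icc 0 T) ν 0 u p → (∃ C : ENNReal, C < ⊤ ∧ ∀ t ∈ Set.Icc 0 T, ∫⁻ x, ‖u t x‖ₑ ^ 2 ≤ C) → Literature.Analysis.FluidPDE.HasRapidSpatialDecay (u 0) → Literature.Analysis.FluidPDE.HasBoundedSobolevNormsOn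 (Set.Icc 0 T) u ∧ Literature.Analysis.FluidPDE.MemLqLp ⊤ ⊤ u (Set.Ioo 0 T)) → (∀ (ν T : ℝ), 0 < ν → 0 < T → ∀ (u : ℝ → EuclideanSpace ℝ (Fin 3) → EuclideanSpace ℝ (Fin 3)) (p : ℝ → EuclideanSpace ℝ (Fin 3) → ℝ), Literature.Analysis.FluidPDE.IsClassicalNSSolutionOn (Set.Ico 0 T) ν 0 u p → Literature.Analysis.FluidPDE.IsLerayHopfOn T ν 0 (u 0) u → Literature.Analysis.FluidPDE.HasRapidSpatialDecay (u 0) → ∀ T'' < T, Literature.Analysis.FluidPDE.HasBoundedSobolevNormsOn (Set.Icc 0 T'') u) := by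
  intro hslab ν T hν hT u p hsol hLH hdec T'' hT''
  set T₁ : ℝ := max T'' (T / 2) with hT₁
  have hT₁pos : 0 < T₁ := lt_max_of_lt_right (half_pos hT)
  have hT₁lt : T₁ < T := max_lt hT'' (half_lt_self hT)
  have hsol' : Literature.Analysis.FluidPDE.IsClassicalNSSolutionOn (Icc 0 T₁) ν 0 u p :=
    hsol.mono (Icc_subset_Ico_right hT₁lt) (uniqueDiffOn_Icc hT₁pos)
  obtain ⟨C, hC, hCb⟩ := lerayHopf_lintegral_sq_le hν.le hLH
  have := (hslab ν T₁ hν hT₁pos u p hsol' ⟨C, hC, fun t ht => hCb t ⟨ht.1, ht.2.trans hT₁lt.le⟩⟩ hdec).1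
  exact this.mono (Icc_subset_Icc_right (le_max_left _ _))

end Literature.NS
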